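import Summits.BirchSwinnertonDyer.BirchSwinnertonDyer.Theorems.EisensteinPrimesMazurMCOnCellBTwistbackQuadraticRadical
import Literature.NumberTheory.EllipticCurves.GreenbergVatsal2000.NonPrimitiveSelmerGroup
import Literature.NumberTheory.EllipticCurves.ArtinFormalismQuadraticLocalProofs
import Literature.NumberTheory.EllipticCurves.QuadraticTwistRamifiedLocalPolynomialProofs
import Literature.NumberTheory.EllipticCurves.LFunctionSmulProofs
import Literature.NumberTheory.EllipticCurves.StrictSelmerRankOneDegreeOneProofs
import Literature.NumberTheory.GaloisRepresentations.DegreeOnePlacesProofs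
import Literature.NumberTheory.QuadraticFields.KroneckerSplitting
import Literature.NumberTheory.QuadraticFields.DiscriminantCharacter
import HarnessLib

/-!
# Crux 3 `MazurMCOnCellB` (stmt-BirchSwinnertonDyer-19033), line `twistback` v4 — the TWIST-CHARACTER
# DICTIONARY, part 4 (local balance): «c(E^K) = c(E)» — the LOCAL BALANCE of the KL-flat door at the
# twist `E^{(d_K)}` over `S₀ ∪ {ℓ ∣ d_K}` EQUALS the local balance of `E` over `S₀`, when the primes of `S₀`
# split in `K` (Heegner) and `E` is good at the primes of `d_K`

Width seat bsd-line-x2-p1-w3 (gen 8), cell `bsd-eis` (run/shared/lean/pub/bsd-eis/), 2026-08-28. HONEST FRAMING: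
bookkeeping of local Euler factors and Dirichlet-character values; THEOREMS ONLY (no `def`, no named fact, no `sorry`);
`--supports` stmt-BirchSwinnertonDyer-19033; closes no stub by itself; no summit statement, no Mazur main conjecture
and no BSD is proved for any curve; 0 cells / labels / tiers move.

WHY (LEAD bsd-line-x2-p1 g9/g10: `Lines/twistback-lambda-formula-validation-g9.md` — the local count `c(E)` of
Greenberg–Vatsal's λ-formula is `K`-INDEPENDENT on 51/51 census cells; verdict g10 §4(2) «make c(E^K) = c(E) a kernel
statement about E and K»). The door `…TwistbackKLFlatPartner` §1/§3 (p645525) asks at the carrier `V′` of the twist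
for the balance `1 + Σ_{v∈S₀′} δ_{V′}^{(v)} = Σ_{v∈S₀′} s_v([φ′(ℓ_v) = ℓ̄_v] + [ψ′(ℓ_v) = ℓ̄_v])` with
`δ = GreenbergVatsal2000.delta` (`= s_ℓ · d_ℓ`, `d_ℓ` the multiplicity of `ℓ̄⁻¹` as a root of `L_ℓ(E,T) mod p`)
and `φ′ = φχ̄`, `ψ′ = ψχ̄` (parts 1–3). This file proves that balance EQUIVALENT to the balance of `W` over `S₀`:

* §1 `localPolynomialAt_smul`, `delta_eq_of_localPolynomialAt_eq`, `delta_smul` — `δ` is a function of Mathlib's local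
  polynomial, hence a `ℚ`-isomorphism invariant (tree `localPolynomial_smul`).
* §2 `delta_twist_eq_of_split` — at a place `v` SPLIT in the quadratic field `K` (a place `w ∣ v` with
  `e(w|v) = f(w|v) = 1`), every model `Wd` of `E^{(d_K)}` has `δ_{Wd}^{(v)} = δ_E^{(v)}` (Artin formalism, split
  case: `L_v(E^{(d_K)}) = L_v(E)`, tree `localPolynomialAt_baseChange_quadratic`); `delta_twist_eq_of_heegner` —
  the same for a prime `ℓ_v ∣ N` under the Heegner hypothesis `SatisfiesHeegnerHypothesis N K`.
* §3 `delta_twist_eq_zero_of_dvd_discr` — at `v` with `ℓ_v ∣ d_K` and `E` GOOD at `v`: `δ_{Wd}^{(v)} = 0`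
  (`L_v(E^{(d_K)}) = 1`, tree `localPolynomialAt_quadraticTwist_discr_eq_one_of_dvd`).
* §4 character values: `twistChar_natCast_of_apply_eq_one` (`χ(ℓ) = 1 ⟹ (φχ̄)(ℓ) = φ(ℓ)`),
  `twistChar_natCast_of_not_coprime` (`gcd(ℓ, N) ≠ 1`, e.g. a prime `ℓ ∣ N`: `(φχ̄)(ℓ) = 0`),
  `jacobiSym_eq_one_of_split` / `chi_natCast_eq_one_of_heegner` —
  `χ_{d_K}(ℓ) = (ℓ/|d_K|) = (d_K/ℓ) = 1` at an ODD prime `ℓ` split in `K` (tree `ncard_primesOver_eq_two_iff_jacobiSym`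
  + reciprocity `jacobiSym_natCast_natAbs_eq`; part 3 gives `χ(a) = (a/|d_K|)`).
* §5 `balance_union_iff` — the transfer: for disjoint `S₀`, `T` with `δ′ = δ` and equal indicators on `S₀`, and
  `δ′ = 0`, vanishing indicators on `T`:
  `n + Σ_{S₀∪T} δ′ = Σ_{S₀∪T} ind′ ↔ n + Σ_{S₀} δ = Σ_{S₀} ind` — «c(E^K) = c(E)».

NOT here: the `S₀`-clauses of the door for the twist (`V′` good outside `S₀ ∪ T ∪ {p}`), `ℓ = 2 ∈ S₀` for the
indicator transfer (needs `(2/|d_K|)` vs `d_K ≡ 1 (mod 8)`; the `δ`-transfer §2 covers `ℓ = 2`), isogeny invariance of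
`δ` for the second X2b shape (`L_v` is an isogeny invariant), the existence of admissible `K`.

References: [GreenbergVatsal2000] §1 (9) p. 9, §2 Prop. (2.4) p. 22, §3 (28) p. 42; [IrelandRosen1990] Ch. 20 §5
Prop. 20.5.4(b) (Artin formalism for a quadratic base change), Ch. 5 §2; [Cox2013] §1.C (1.17); [SilvermanAEC2009]
App. C §16.
-/

set_option autoImplicit false

-- `Summit.BirchSwinnertonDyer.BirchSwinnertonDyer.…`: the summit and its single sub-problem share a name.
set_option linter.dupNamespace false

noncomputable section

open scoped Classical NumberTheorySymbols

open WeierstrassCurve NumberField IsDedekindDomain Polynomial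
  Literature.NumberTheory.GaloisRepresentations Literature.NumberTheory.EllipticCurves
  Literature.NumberTheory.EllipticCurves.GreenbergVatsal2000
  Literature.NumberTheory.QuadraticFields.Quadratic
  Summit.BirchSwinnertonDyer.BirchSwinnertonDyer.Theorems.EisensteinPrimesMazurMCOnCellBTwistbackTwistLineCharacters

namespace Summit.BirchSwinnertonDyer.BirchSwinnertonDyer.Theorems.EisensteinPrimesMazurMCOnCellBTwistbackTwistLocalBalance

/-! ## §1. `δ` is a function of the local polynomial: model invariance -/

section Delta

variable {W W' : WeierstrassCurve ℚ} (p : ℕ) (v : HeightOneSpectrum (𝓞 ℚ))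

/-- **Mathlib's local polynomial is a `ℚ`-isomorphism invariant**: `L_v(C • W) = L_v(W)` (tree
`localPolynomial_smul` for the base change to `ℚ_v`). [cite: SilvermanAEC2009, App. C §16 with VII.1 Prop. 1.3(b)] -/
theorem localPolynomialAt_smul [W.IsElliptic] (C : VariableChange ℚ) :
    (C • W).localPolynomialAt v = W.localPolynomialAt v := by
  change localPolynomial (v.adicCompletionIntegers ℚ) ((C • W).baseChange (v.adicCompletion ℚ)) =
    localPolynomial (v.adicCompletionIntegers ℚ) (W.baseChange (v.adicCompletion ℚ))
  rw [baseChange, baseChange, ← map_variableChange]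
  exact localPolynomial_smul _ _ _

omit v in
/-- **`δ` only depends on the local polynomial**: if `L_v(W′) = L_v(W)` then `δ_{W′}^{(v)} = δ_W^{(v)}`
(`δ = s_ℓ · mult_{ℓ̄⁻¹}(L_v mod p)`). [cite: GreenbergVatsal2000, §2 Prop. (2.4) (p. 22)] -/
theorem delta_eq_of_localPolynomialAt_eq {v : HeightOneSpectrum (𝓞 ℚ)}
    (h : W'.localPolynomialAt v = W.localPolynomialAt v) : delta W' p v = delta W p v := by
  unfold delta dMultiplicity eulerFactorModP
  rw [h]

/-- **`δ` is a `ℚ`-isomorphism invariant**: `δ_{C•W}^{(v)} = δ_W^{(v)}`. [cite: GreenbergVatsal2000, §2 Prop. (2.4) (p. 22)] -/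
theorem delta_smul [W.IsElliptic] (C : VariableChange ℚ) : delta (C • W) p v = delta W p v :=
  delta_eq_of_localPolynomialAt_eq p (localPolynomialAt_smul v C)

/-- **`δ = 0` when the local polynomial is `1`** (additive reduction: no root at all).
[cite: GreenbergVatsal2000, §2 Prop. (2.4) (p. 22)] -/
theorem delta_eq_zero_of_localPolynomialAt_eq_one (h : W.localPolynomialAt v = 1) : delta W p v = 0 := by
  unfold delta dMultiplicity eulerFactorModP
  rw [h, Polynomial.map_one]
  by_cases h1 : (1 : ZMod p) = 0
  · have h0 : (1 : (ZMod p)[X]) = 0 := by rw [← Polynomial.C_1, h1, Polynomial.C_0]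
    rw [h0, Polynomial.rootMultiplicity_zero, mul_zero]
  · rw [Polynomial.rootMultiplicity_eq_zero (by rwa [Polynomial.IsRoot.def, Polynomial.eval_one]), mul_zero]

end Delta

/-! ## §2. `δ` of the twist at a place SPLIT in `K` -/

section Split

variable (W : WeierstrassCurve ℚ) [W.IsElliptic] {Wd : WeierstrassCurve ℚ} [Wd.IsElliptic]
  (K : Type) [Field K] [NumberField K] (p : ℕ)

/-- **`δ_{E^{(d_K)}}^{(v)} = δ_E^{(v)}` at a place split in `K`.** For `K` quadratic, `v` a finite place of `ℚ` with a
place `w ∣ v` of `K` of ramification index and residue degree `1`, and ANY model `Wd` of the twist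
(`C • Wd = W.quadraticTwist d_K`): `δ_{Wd}^{(v)} = δ_W^{(v)}` — Artin formalism in the split case gives
`L_v(E^{(d_K)}, T) = L_v(E, T)` (tree `localPolynomialAt_baseChange_quadratic`), and `δ` is a function of `L_v`.
[cite: IrelandRosen1990, Ch. 20 §5, Prop. 20.5.4(b)] [cite: GreenbergVatsal2000, §2 Prop. (2.4)] -/
theorem delta_twist_eq_of_split (h2 : Module.finrank ℚ K = 2) {v : HeightOneSpectrum (𝓞 ℚ)}
    {w : HeightOneSpectrum (𝓞 K)} (hw : w.asIdeal.under (𝓞 ℚ) = v.asIdeal)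
    (he : w.asIdeal.ramificationIdx (𝓞 ℚ) = 1) (hf : w.asIdeal.inertiaDeg (𝓞 ℚ) = 1)
    (C : VariableChange ℚ) (hC : C • Wd = W.quadraticTwist (NumberField.discr K : ℚ)) :
    delta Wd p v = delta W p v := by
  have h1 := ((W.localPolynomialAt_baseChange_quadratic K h2 hw).1 he hf).2
  rw [← hC, localPolynomialAt_smul v C] at h1
  exact delta_eq_of_localPolynomialAt_eq p h1

/-- **Heegner form**: for `K` quadratic and a prime `ℓ ∣ N` with `SatisfiesHeegnerHypothesis N K` (every prime of
`N` splits in `K`), at the place `v = (ℓ)` every model `Wd` of `E^{(d_K)}` has `δ_{Wd}^{(v)} = δ_W^{(v)}` (the two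
places above `ℓ` have `e = f = 1`, tree `ramificationIdx_eq_one_and_inertiaDeg_eq_one_of_ncard_primesOver_eq_two`).
[cite: IrelandRosen1990, Ch. 20 §5, Prop. 20.5.4(b)] [cite: GrossZagier1986, §I.1 (the Heegner hypothesis)] -/
theorem delta_twist_eq_of_heegner (h2 : Module.finrank ℚ K = 2) {N : ℕ} (hH : SatisfiesHeegnerHypothesis N K)
    (v : HeightOneSpectrum (𝓞 ℚ)) (hvN : Rat.HeightOneSpectrum.natGenerator v ∣ N)
    (C : VariableChange ℚ) (hC : C • Wd = W.quadraticTwist (NumberField.discr K : ℚ)) :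
    delta Wd p v = delta W p v := by
  set ℓ := Rat.HeightOneSpectrum.natGenerator v with hℓ
  have hℓp : ℓ.Prime := Rat.HeightOneSpectrum.prime_natGenerator v
  have hsplit := hH ℓ hℓp hvN
  obtain ⟨w, hwℓ⟩ :=
    Literature.NumberTheory.NumberFields.RingOfIntegers.exists_heightOneSpectrum_natCast_mem K hℓp
  obtain ⟨he, hf⟩ := ramificationIdx_eq_one_and_inertiaDeg_eq_one_of_ncard_primesOver_eq_two ℓ h2 hsplit w hwℓ
  have hℓv : ((ℓ : ℕ) : 𝓞 ℚ) ∈ v.asIdeal := (Rat.natCast_mem_asIdeal_iff v).mpr dvd_rfl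
  have hℓw : ((ℓ : ℕ) : 𝓞 ℚ) ∈ (w.under (𝓞 ℚ)).asIdeal := by
    change algebraMap (𝓞 ℚ) (𝓞 K) (ℓ : 𝓞 ℚ) ∈ w.asIdeal
    rwa [map_natCast]
  have hwv : w.under (𝓞 ℚ) = v := Rat.eq_of_natCast_prime_mem hℓp hℓw hℓv
  exact delta_twist_eq_of_split W K p h2 (congrArg HeightOneSpectrum.asIdeal hwv) he hf C hC

end Split

/-! ## §3. `δ` of the twist at a place dividing `d_K` where `E` is good -/

section Ramified

variable (W : WeierstrassCurve ℚ) [W.IsElliptic] {Wd : WeierstrassCurve ℚ} [Wd.IsElliptic]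
  (K : Type) [Field K] [NumberField K] (p : ℕ)

/-- **`δ_{E^{(d_K)}}^{(v)} = 0` at `ℓ_v ∣ d_K` where `E` is good**: the twist is additive there, `L_v(E^{(d_K)}) = 1`
(tree `localPolynomialAt_quadraticTwist_discr_eq_one_of_dvd`, from the ramified case of Artin formalism), so the
reduced Euler factor has no root. [cite: IrelandRosen1990, Ch. 20 §5, Prop. 20.5.4(b)] [cite: GreenbergVatsal2000, §2 Prop. (2.4)] -/
theorem delta_twist_eq_zero_of_dvd_discr (h2 : Module.finrank ℚ K = 2) (v : HeightOneSpectrum (𝓞 ℚ))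
    (hv : ((Rat.HeightOneSpectrum.natGenerator v : ℕ) : ℤ) ∣ NumberField.discr K)
    (hgood : W.HasGoodReductionAt v)
    (C : VariableChange ℚ) (hC : C • Wd = W.quadraticTwist (NumberField.discr K : ℚ)) :
    delta Wd p v = 0 := by
  have h1 := W.localPolynomialAt_quadraticTwist_discr_eq_one_of_dvd K h2 v hv hgood
  rw [← hC, localPolynomialAt_smul v C] at h1
  exact delta_eq_zero_of_localPolynomialAt_eq_one p v h1

end Ramified

/-! ## §4. The values of the twisted characters at the primes of `S₀` and of `d_K` -/

section Values

variable {p : ℕ} {m N : ℕ} [NeZero m] [NeZero N]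

/-- **`(φχ̄)(ℓ) = φ(ℓ)` when `χ(ℓ) = 1`** (a prime `ℓ` split in `ℚ(√D)`).
[cite: Washington1997, Ch. 3 (Dirichlet characters; values of a product)] -/
theorem twistChar_natCast_of_apply_eq_one (φ : DirichletCharacter (ZMod p) m) (χ : MulChar (ZMod N) ℤ)
    {ℓ : ℕ} (hχ : χ (ℓ : ZMod N) = 1) :
    (DirichletCharacter.changeLevel (dvd_mul_right m N) φ *
        DirichletCharacter.changeLevel (dvd_mul_left N m) (χ.ringHomComp (Int.castRingHom (ZMod p))) :
      DirichletCharacter (ZMod p) (m * N)) (ℓ : ZMod (m * N)) = φ (ℓ : ZMod m) := by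
  rw [changeLevel_mul_changeLevel_apply_natCast, ringHomComp_apply_eq_intCast, hχ, Int.cast_one, mul_one]

/-- **`(φχ̄)(ℓ) = 0` when `ℓ` is not coprime to `N`** (a prime `ℓ ∣ N = |d_K|`: `χ` vanishes off the units).
[cite: Washington1997, Ch. 3] -/
theorem twistChar_natCast_of_not_coprime (φ : DirichletCharacter (ZMod p) m) (χ : MulChar (ZMod N) ℤ)
    {ℓ : ℕ} (hℓ : ¬ ℓ.Coprime N) :
    (DirichletCharacter.changeLevel (dvd_mul_right m N) φ *
        DirichletCharacter.changeLevel (dvd_mul_left N m) (χ.ringHomComp (Int.castRingHom (ZMod p))) :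
      DirichletCharacter (ZMod p) (m * N)) (ℓ : ZMod (m * N)) = 0 := by
  rw [changeLevel_mul_changeLevel_apply_natCast, ringHomComp_apply_eq_intCast,
    MulChar.map_nonunit χ (fun h ↦ hℓ ((ZMod.isUnit_iff_coprime ℓ N).mp h)), Int.cast_zero, mul_zero]

/-- **`(ℓ/|d_K|) = 1` at an ODD prime `ℓ` split in the quadratic field `K` with `d_K ≡ 1 (mod 4)`**: splitting is
`(d_K/ℓ) = 1` (tree `ncard_primesOver_eq_two_iff_jacobiSym`) and `(ℓ/|d_K|) = (d_K/ℓ)` (reciprocity, Cox (1.17),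
tree `jacobiSym_natCast_natAbs_eq`). With part 3's `χ(a) = (a/|d_K|)` this is `χ_{d_K}(ℓ) = 1`.
[cite: Cox2013, §1.C Lemma 1.14 and (1.17)] [cite: IrelandRosen1990, Ch. 13 §1 (splitting of primes in quadratic fields)] -/
theorem jacobiSym_eq_one_of_split {K : Type} [Field K] [NumberField K] (h2 : Module.finrank ℚ K = 2)
    (hD : NumberField.discr K % 4 = 1) {ℓ : ℕ} (hℓ : ℓ.Prime) (hℓ2 : ℓ ≠ 2)
    (hsplit : ((Ideal.span {(ℓ : ℤ)}).primesOver (𝓞 K)).ncard = 2) :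
    J((ℓ : ℤ) | (NumberField.discr K).natAbs) = 1 := by
  rw [jacobiSym_natCast_natAbs_eq hD (hℓ.odd_of_ne_two hℓ2)]
  exact (ncard_primesOver_eq_two_iff_jacobiSym h2 hℓ hℓ2).mp hsplit

/-- **`χ_{d_K}(ℓ) = 1` at an odd prime `ℓ ∣ N` under the Heegner hypothesis**, for any `ℤ`-valued character `χ`
modulo `|d_K|` with `χ(a) = (a/|d_K|)` (part 3's Jacobi character), `d_K ≡ 1 (mod 4)`.
[cite: Cox2013, §1.C (1.17)] [cite: GrossZagier1986, §I.1 (the Heegner hypothesis)] -/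
theorem chi_natCast_eq_one_of_heegner {K : Type} [Field K] [NumberField K] (h2 : Module.finrank ℚ K = 2)
    (hD : NumberField.discr K % 4 = 1) {N₀ : ℕ} (hH : SatisfiesHeegnerHypothesis N₀ K)
    (χ : MulChar (ZMod (NumberField.discr K).natAbs) ℤ)
    (hχ : ∀ a : ℕ, χ (a : ZMod (NumberField.discr K).natAbs) = J((a : ℤ) | (NumberField.discr K).natAbs))
    {ℓ : ℕ} (hℓ : ℓ.Prime) (hℓ2 : ℓ ≠ 2) (hℓN : ℓ ∣ N₀) :
    χ (ℓ : ZMod (NumberField.discr K).natAbs) = 1 := by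
  rw [hχ]
  exact jacobiSym_eq_one_of_split h2 hD hℓ hℓ2 (hH ℓ hℓ hℓN)

end Values

/-! ## §5. The transfer «c(E^K) = c(E)» of the local balance -/

section Balance

variable {p : ℕ} {W Wd : WeierstrassCurve ℚ}

/-- **«c(E^K) = c(E)»: the local balance of the door transfers from `S₀` to `S₀ ∪ T`.** Let `S₀`, `T` be disjoint
finite sets of places; `δ′ = δ` and equal indicator values on `S₀` (split places: §2 and §4), `δ′ = 0` and both
twisted characters vanishing at `ℓ_v` with `ℓ_v ≢ 0 (mod p)` on `T` (the primes of `d_K`: §3 and §4). Then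
`n + Σ_{S₀∪T} δ′ = Σ_{S₀∪T} (s[φ′=ℓ̄] + s[ψ′=ℓ̄])  ↔  n + Σ_{S₀} δ = Σ_{S₀} (s[φ=ℓ̄] + s[ψ=ℓ̄])` — the balance
hypothesis of `…TwistbackKLFlatPartner` §1/§3 at the twist from the balance of `E` (GV's λ-count is `K`-independent).
[cite: GreenbergVatsal2000, §3 (28) p. 42 and §2 Prop. (2.4) p. 22] -/
theorem balance_union_iff {m d m' d' : ℕ} [NeZero m] [NeZero d] [NeZero m'] [NeZero d']
    (φ : DirichletCharacter (ZMod p) m) (ψ : DirichletCharacter (ZMod p) d)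
    (φ' : DirichletCharacter (ZMod p) m') (ψ' : DirichletCharacter (ZMod p) d')
    (S₀ T : Finset (HeightOneSpectrum (𝓞 ℚ))) (hST : Disjoint S₀ T)
    (hδS : ∀ v ∈ S₀, delta Wd p v = delta W p v) (hδT : ∀ v ∈ T, delta Wd p v = 0)
    (hφS : ∀ v ∈ S₀, φ' (Rat.HeightOneSpectrum.natGenerator v : ZMod m') =
      φ (Rat.HeightOneSpectrum.natGenerator v : ZMod m))
    (hψS : ∀ v ∈ S₀, ψ' (Rat.HeightOneSpectrum.natGenerator v : ZMod d') =
      ψ (Rat.HeightOneSpectrum.natGenerator v : ZMod d))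
    (hφT : ∀ v ∈ T, φ' (Rat.HeightOneSpectrum.natGenerator v : ZMod m') = 0)
    (hψT : ∀ v ∈ T, ψ' (Rat.HeightOneSpectrum.natGenerator v : ZMod d') = 0)
    (hTp : ∀ v ∈ T, (Rat.HeightOneSpectrum.natGenerator v : ZMod p) ≠ 0) (n : ℕ) :
    (n + ∑ v ∈ S₀ ∪ T, delta Wd p v =
        ∑ v ∈ S₀ ∪ T, ((if φ' (Rat.HeightOneSpectrum.natGenerator v : ZMod m') =
              (Rat.HeightOneSpectrum.natGenerator v : ZMod p)
            then sFactor p (Rat.HeightOneSpectrum.natGenerator v) else 0) +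
          (if ψ' (Rat.HeightOneSpectrum.natGenerator v : ZMod d') =
              (Rat.HeightOneSpectrum.natGenerator v : ZMod p)
            then sFactor p (Rat.HeightOneSpectrum.natGenerator v) else 0))) ↔
      (n + ∑ v ∈ S₀, delta W p v =
        ∑ v ∈ S₀, ((if φ (Rat.HeightOneSpectrum.natGenerator v : ZMod m) =
              (Rat.HeightOneSpectrum.natGenerator v : ZMod p)
            then sFactor p (Rat.HeightOneSpectrum.natGenerator v) else 0) +
          (if ψ (Rat.HeightOneSpectrum.natGenerator v : ZMod d) =
              (Rat.HeightOneSpectrum.natGenerator v : ZMod p)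
            then sFactor p (Rat.HeightOneSpectrum.natGenerator v) else 0))) := by
  -- `δ′`: the `T`-part vanishes, the `S₀`-part is that of `W`
  have hδ : ∑ v ∈ S₀ ∪ T, delta Wd p v = ∑ v ∈ S₀, delta W p v := by
    rw [Finset.sum_union hST, Finset.sum_eq_zero (s := T) (fun v hv ↦ hδT v hv), add_zero]
    exact Finset.sum_congr rfl fun v hv ↦ hδS v hv
  -- indicators: the `T`-part vanishes (`φ′(ℓ) = 0 ≠ ℓ̄`), the `S₀`-part is that of `(φ, ψ)`
  have hind : ∑ v ∈ S₀ ∪ T, ((if φ' (Rat.HeightOneSpectrum.natGenerator v : ZMod m') =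
              (Rat.HeightOneSpectrum.natGenerator v : ZMod p)
            then sFactor p (Rat.HeightOneSpectrum.natGenerator v) else 0) +
          (if ψ' (Rat.HeightOneSpectrum.natGenerator v : ZMod d') =
              (Rat.HeightOneSpectrum.natGenerator v : ZMod p)
            then sFactor p (Rat.HeightOneSpectrum.natGenerator v) else 0)) =
      ∑ v ∈ S₀, ((if φ (Rat.HeightOneSpectrum.natGenerator v : ZMod m) =
              (Rat.HeightOneSpectrum.natGenerator v : ZMod p)
            then sFactor p (Rat.HeightOneSpectrum.natGenerator v) else 0) +
          (if ψ (Rat.HeightOneSpectrum.natGenerator v : ZMod d) =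
              (Rat.HeightOneSpectrum.natGenerator v : ZMod p)
            then sFactor p (Rat.HeightOneSpectrum.natGenerator v) else 0)) := by
    rw [Finset.sum_union hST, Finset.sum_eq_zero (s := T), add_zero]
    · exact Finset.sum_congr rfl fun v hv ↦ by rw [hφS v hv, hψS v hv]
    · intro v hv
      have hne : ¬ (0 : ZMod p) = (Rat.HeightOneSpectrum.natGenerator v : ZMod p) :=
        fun h ↦ hTp v hv h.symm
      rw [hφT v hv, hψT v hv, if_neg hne, add_zero]
  rw [hδ, hind]

end Balance

end Summit.BirchSwinnertonDyer.BirchSwinnertonDyer.Theorems.EisensteinPrimesMazurMCOnCellBTwistbackTwistLocalBalance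

end
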